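import Mathlib
import Summits.Ventures.PercRepro2.Defs
import Summits.Ventures.PercRepro2.Graph
import Summits.Ventures.PercRepro2.Induced
import Summits.Ventures.PercRepro2.VdBKahn
import Summits.Ventures.PercRepro2.ReimerVdBK
import Summits.Ventures.PercRepro2.ReimerVdBKTwisted
import Summits.Ventures.PercRepro2.ReimerVdBKTied
import Summits.Ventures.PercRepro2.ReimerVdBKCoreDown
import Summits.Ventures.PercRepro2.ReimerVdBKDegTwoCalc
import Summits.Ventures.PercRepro2.ReimerVdBKOuter
import Summits.Ventures.PercRepro2.ReimerVdBKPatch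
import Summits.Ventures.PercRepro2.ReimerVdBKOuterStars
import Summits.Ventures.PercRepro2.ReimerVdBKCellEdges
import Summits.Ventures.PercRepro2.ReimerVdBKCell
import Summits.Ventures.PercRepro2.ReimerVdBKCellCoin
import Summits.Ventures.PercRepro2.ReimerVdBKCellSets
import Summits.Ventures.PercRepro2.ReimerVdBKCellTriple

/-!
# `XYY`: the `X`-vertex adjacent to both `Y`-vertices takes one coin (`N = ∅`)
(blind cell PercRepro2, mine-c g50; `conjectures/MINE-C.md` §59.1–59.3 — part VII of the cell theorem;
part VI `ReimerVdBKCellTriple`: the pairing lemma and the `XXY` shape)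

`oneCoin_XYY` — `a ∈ X`, `b, c ∈ Y`, edges `a b` and `a c`: a cell with a red edge from `a` to `b` AND a
red edge from `a` to `c` forces `b` and `c` outside the world-1 cluster (`X`-like: flip the outer stars,
keep the inner edges), any other cell has a blue edge at `a`, which is then outside the world-2 cluster
with its `Y`-neighbour (`Y`-like: keep).  The mirror of `oneCoin_XXY`; the census of `MINE-C.md` §59.1 (c)
says the one coin of an `XYY` triple survives exactly when the `X`-vertex is adjacent to both `Y`-vertices.
-/

namespace Summit.Ventures.PercRepro2
namespace ReimerVdBK
open Classical

variable {V : Type*} {E : Type*} [Fintype E] [DecidableEq E] [Fintype V] [DecidableEq V]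

/-! ## `XYY`: the `X`-vertex adjacent to both `Y`-vertices -/

section XYY
variable (ends : E → Sym2 V) (s : V) (A X B Y : Finset V) (a b c : V)

/-- The target of a cell of `{a, b, c}` (`a ∈ X`, `b, c ∈ Y`): the outer stars flipped when `a` has a red
edge to `b` AND a red edge to `c`, the cell itself otherwise. -/
def xyyTarget (d : Config E) : Config E :=
  if (∃ e, ends e = s(a, b) ∧ d e = true) ∧ (∃ e, ends e = s(a, c) ∧ d e = true) then
    flipOn (FE ends {a, b, c}) d else d

/-- The flip of the outer edges does not change the inner edges of the triple. -/
lemma flipOn_FE_inner_triple (d : Config E) {e : E} {x y : V} (hx : x ∈ ({a, b, c} : Finset V))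
    (hy : y ∈ ({a, b, c} : Finset V)) (he : ends e = s(x, y)) : flipOn (FE ends {a, b, c}) d e = d e :=
  flipOn_of_not_mem _ (not_mem_FE_of_ends ends hx hy he) d

/-- `xyyTarget` is an involution. -/
lemma xyyTarget_involutive : Function.Involutive (xyyTarget ends a b c) := by
  intro d
  unfold xyyTarget
  have haR : a ∈ ({a, b, c} : Finset V) := Finset.mem_insert_self _ _
  have hbR : b ∈ ({a, b, c} : Finset V) := Finset.mem_insert_of_mem (Finset.mem_insert_self _ _)
  have hcR : c ∈ ({a, b, c} : Finset V) :=
    Finset.mem_insert_of_mem (Finset.mem_insert_of_mem (Finset.mem_singleton_self _))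
  by_cases h : (∃ e, ends e = s(a, b) ∧ d e = true) ∧ (∃ e, ends e = s(a, c) ∧ d e = true)
  · rw [if_pos h]
    have h' : (∃ e, ends e = s(a, b) ∧ flipOn (FE ends {a, b, c}) d e = true) ∧
        (∃ e, ends e = s(a, c) ∧ flipOn (FE ends {a, b, c}) d e = true) := by
      obtain ⟨⟨e₁, he₁, hd₁⟩, ⟨e₂, he₂, hd₂⟩⟩ := h
      exact ⟨⟨e₁, he₁, by rw [flipOn_FE_inner_triple ends a b c d haR hbR he₁]; exact hd₁⟩,
        ⟨e₂, he₂, by rw [flipOn_FE_inner_triple ends a b c d haR hcR he₂]; exact hd₂⟩⟩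
    rw [if_pos h', flipOn_involutive]
  · rw [if_neg h, if_neg h]

/-- `xyyTarget` preserves every one-coin fibre. -/
lemma xyyTarget_mem_coinFibre_iff (c' d : Config E) :
    xyyTarget ends a b c d ∈ coinFibre ends c' {a, b, c} ↔ d ∈ coinFibre ends c' {a, b, c} := by
  unfold xyyTarget
  by_cases h : (∃ e, ends e = s(a, b) ∧ d e = true) ∧ (∃ e, ends e = s(a, c) ∧ d e = true)
  · rw [if_pos h]
    exact flipOn_mem_shiftTied_iff c' d _
  · rw [if_neg h]

/-- **The cell inequality for `XYY` with the `X`-vertex adjacent to both `Y`-vertices.** -/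
theorem count_cell_xyy_le (ha : a ∈ X) (hb : b ∈ Y) (hc : c ∈ Y) (hXY : X ∩ Y = ∅)
    (hab : ∃ e, ends e = s(a, b)) (hac : ∃ e, ends e = s(a, c)) (d : Config E) :
    count (twoWorld ends s A X B Y ∩ onF (edgesTouching ends {a, b, c}) d) ≤
      count (twoWorld ends s (A ∪ B) ∅ ∅ (X ∪ Y) ∩ onF (edgesTouching ends {a, b, c}) (xyyTarget ends a b c d)) := by
  have haR : a ∈ ({a, b, c} : Finset V) := Finset.mem_insert_self _ _
  have hbR : b ∈ ({a, b, c} : Finset V) := Finset.mem_insert_of_mem (Finset.mem_insert_self _ _)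
  have hcR : c ∈ ({a, b, c} : Finset V) :=
    Finset.mem_insert_of_mem (Finset.mem_insert_of_mem (Finset.mem_singleton_self _))
  have hnotY : ∀ w ∈ X, w ∉ Y := fun w hw hwY => Finset.notMem_empty w (hXY ▸ Finset.mem_inter.2 ⟨hw, hwY⟩)
  have hbX : b ∉ X := fun h => hnotY b h hb
  have hcX : c ∉ X := fun h => hnotY c h hc
  have hRX : ({a, b, c} : Finset V) ∩ X ⊆ {a} := by
    intro w hw
    rcases Finset.mem_insert.1 (Finset.mem_inter.1 hw).1 with rfl | hw'
    · exact Finset.mem_singleton_self _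
    · rcases Finset.mem_insert.1 hw' with rfl | hw''
      · exact absurd (Finset.mem_inter.1 hw).2 hbX
      · rw [Finset.mem_singleton.1 hw''] at hw
        exact absurd (Finset.mem_inter.1 hw).2 hcX
  have hRY : ({a, b, c} : Finset V) ∩ Y ⊆ {b, c} := by
    intro w hw
    rcases Finset.mem_insert.1 (Finset.mem_inter.1 hw).1 with rfl | hw'
    · exact absurd (Finset.mem_inter.1 hw).2 (hnotY _ ha)
    · exact hw'
  unfold xyyTarget
  by_cases hred : (∃ e, ends e = s(a, b) ∧ d e = true) ∧ (∃ e, ends e = s(a, c) ∧ d e = true)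
  · -- red edges from `a` to both `b` and `c`: the triple is `X`-like
    rw [if_pos hred]
    obtain ⟨⟨e₁, he₁, hd₁⟩, ⟨e₂, he₂, hd₂⟩⟩ := hred
    refine count_cell_le ends s A X B Y {a, b, c} {a, b, c} {b, c} Finset.inter_subset_left hRY {a, b, c}
      (le_refl _) Finset.sdiff_subset d _ ?_ ?_ ?_ ?_ ?_ ?_
    · intro ω' hω' w hw
      obtain ⟨⟨_, hX⟩, _⟩ := hω'
      have ha' : ¬ Conn ends (patch (edgesTouching ends {a, b, c}) d ω') s a := hX a ha
      have hopen : ∀ e, e ∈ edgesTouching ends {a, b, c} → d e = true →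
          patch (edgesTouching ends {a, b, c}) d ω' e = true := by
        intro e heR hde
        rw [patch_of_mem _ heR]; exact hde
      rcases Finset.mem_insert.1 hw with rfl | hw'
      · exact ha'
      rcases Finset.mem_insert.1 hw' with rfl | hw''
      · intro hcw
        exact ha' (conn_trans hcw (conn_of_openAdj
          ⟨e₁, hopen e₁ (mem_edgesTouching_of_ends ends haR he₁) hd₁, by rw [he₁, Sym2.eq_swap]⟩))
      · rw [Finset.mem_singleton.1 hw'']
        intro hcw
        exact ha' (conn_trans hcw (conn_of_openAdj
          ⟨e₂, hopen e₂ (mem_edgesTouching_of_ends ends haR he₂) hd₂, by rw [he₂, Sym2.eq_swap]⟩))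
    · intro ω' hω' w hw
      obtain ⟨_, _, hY⟩ := hω'
      rcases Finset.mem_insert.1 hw with rfl | hw'
      · exact hY w hb
      · rw [Finset.mem_singleton.1 hw']
        exact hY c hc
    · intro e heR _ hnone
      obtain ⟨w, hw, hwe⟩ := (mem_edgesAt_iff ends).1 heR
      exact absurd hwe (hnone w hw)
    · intro e heR hnd hnone
      -- a non-loop edge at the triple missing `b` and `c` is an outer-star edge of `a`
      obtain ⟨w, hw, hwe⟩ := (mem_edgesAt_iff ends).1 heR
      have hwa : w = a := by
        rcases Finset.mem_insert.1 hw with rfl | hw'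
        · rfl
        · exact absurd hwe (hnone w hw')
      subst hwa
      obtain ⟨x, hx⟩ := Sym2.mem_iff_exists.1 hwe
      have hstar : e ∈ outerStar ends {w, b, c} w := by
        refine (mem_outerStar_iff ends).2 ⟨x, hx, ?_⟩
        intro hxR
        rcases Finset.mem_insert.1 hxR with rfl | hxR'
        · exact hnd (by rw [hx]; exact Sym2.mk_isDiag_iff.2 rfl)
        · exact hnone x hxR' (by rw [hx]; exact Sym2.mem_mk_right _ _)
      have hFE : e ∈ FE ends {w, b, c} := (mem_outerEdges_iff ends _).2 ⟨w, Finset.mem_insert_self _ _, hstar⟩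
      rw [flipOn_of_mem _ hFE]
    · intro w hw e he
      have hFE : e ∈ FE ends {a, b, c} := (mem_outerEdges_iff ends _).2 ⟨w, hw, he⟩
      exact flipOn_of_mem _ hFE d
    · intro w hw
      exact absurd (Finset.mem_sdiff.1 hw).1 (Finset.mem_sdiff.1 hw).2
  · -- some blue edge at `a` inside the triple: the triple is `Y`-like
    rw [if_neg hred]
    refine count_cell_le ends s A X B Y {a, b, c} {a} {a, b, c} hRX Finset.inter_subset_left ∅
      (Finset.empty_subset _) ?_ d d ?_ ?_ ?_ ?_ ?_ ?_
    · intro w hw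
      exact absurd (Finset.mem_sdiff.1 hw).1 (Finset.mem_sdiff.1 hw).2
    · intro ω' hω' w hw
      obtain ⟨⟨_, hX⟩, _⟩ := hω'
      rw [Finset.mem_singleton.1 hw]
      exact hX a ha
    · intro ω' hω' w hw
      obtain ⟨_, _, hY⟩ := hω'
      have hblue : ∀ e, e ∈ edgesTouching ends {a, b, c} → d e = false →
          compl (patch (edgesTouching ends {a, b, c}) d ω') e = true := by
        intro e heR hde
        simp only [compl]
        rw [patch_of_mem _ heR, hde]
        rfl
      -- `a` is outside the world-2 cluster through a blue edge to `b` or to `c`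
      have ha2 : ¬ Conn ends (compl (patch (edgesTouching ends {a, b, c}) d ω')) s a := by
        intro haw
        rw [not_and_or] at hred
        rcases hred with h | h
        · obtain ⟨e₁, he₁⟩ := hab
          have hd₁ : d e₁ = false := by
            cases hd : d e₁
            · rfl
            · exact absurd ⟨e₁, he₁, hd⟩ h
          exact hY b hb (conn_trans haw (conn_of_openAdj
            ⟨e₁, hblue e₁ (mem_edgesTouching_of_ends ends haR he₁) hd₁, he₁⟩))
        · obtain ⟨e₂, he₂⟩ := hac
          have hd₂ : d e₂ = false := by
            cases hd : d e₂
            · rfl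
            · exact absurd ⟨e₂, he₂, hd⟩ h
          exact hY c hc (conn_trans haw (conn_of_openAdj
            ⟨e₂, hblue e₂ (mem_edgesTouching_of_ends ends haR he₂) hd₂, he₂⟩))
      rcases Finset.mem_insert.1 hw with rfl | hw'
      · exact ha2
      rcases Finset.mem_insert.1 hw' with rfl | hw''
      · exact hY w hb
      · rw [Finset.mem_singleton.1 hw'']
        exact hY c hc
    · intro e _ _ _
      exact le_refl _
    · intro e heR _ hnone
      obtain ⟨w, hw, hwe⟩ := (mem_edgesAt_iff ends).1 heR
      exact absurd hwe (hnone w hw)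
    · intro w hw
      exact absurd hw (Finset.notMem_empty w)
    · intro _ _ _ _
      rfl

/-- **`XYY` takes one coin when the `X`-vertex is adjacent to both `Y`-vertices** (`N = ∅`). -/
theorem oneCoin_XYY (ha : a ∈ X) (hb : b ∈ Y) (hc : c ∈ Y) (hXY : X ∩ Y = ∅)
    (hab : ∃ e, ends e = s(a, b)) (hac : ∃ e, ends e = s(a, c)) :
    OneCoin ends s A X B Y ∅ {a, b, c} :=
  oneCoin_of_cell_pairing ends s A X B Y {a, b, c} (xyyTarget ends a b c) (xyyTarget_involutive ends a b c)
    (xyyTarget_mem_coinFibre_iff ends a b c) (count_cell_xyy_le ends s A X B Y a b c ha hb hc hXY hab hac)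

end XYY

end ReimerVdBK
end Summit.Ventures.PercRepro2
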